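import Mathlib
import HarnessLib
import Summits.NavierStokesRegularity.NavierStokesRegularity.Theorems.ChiralWindowDoorDefs
import Summits.NavierStokesRegularity.NavierStokesRegularity.Theorems.CriticalFluxDoorDefs
import Summits.NavierStokesRegularity.NavierStokesRegularity.Theorems.RellichScarDefs
import Summits.NavierStokesRegularity.NavierStokesRegularity.Theorems.ChiralWindowDoorHelicityFluxBounds
import Summits.NavierStokesRegularity.NavierStokesRegularity.Theorems.CriticalFluxDoorLambdaDecay

/-!
# Door S21-C «CriticalFluxDoor» — the ANNULUS FLUXES of the windowed critical-energy budget are `O(R²/(R+√(−t))⁴)`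
# (F3-DERIVATION §2 (a), (b): pressure flux and cut-off cross term)

Door S21-C of nsreg-p1's local Type-I door family (`HOME/ns-regularity-ideate-p1/ROUND-20.md` §2b F3,
`r20/F3-DERIVATION.md` §2; DESIGN-ONLY, route NOT born).  In the identity
`d/dt Q(a_R, v) = 2∫q ∇a_R·Λv − 2∑ᵢ∫∂ᵢa_R⟪∂ᵢv, Λv⟫ − 2∑ᵢQ(a_R,∂ᵢv) − 2∫a_RΦ(v) + ∫⟪[Λ,a_R]v, ∂ₜv⟫`
(`…CriticalFluxDoorCritEnergyIdentity`) the two terms carrying `∇a_R` live on the annulus `R ≤ ‖x‖ ≤ 2R`, where the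
scale-invariant package gives `|q| ≤ L/(R+√s)²`, `‖∇v‖ ≤ L/(R+√s)²`, `‖Λv‖ ≤ K′/(R+√s)²` (the weighted `Λ`-decay lemma,
`…CriticalFluxDoorLambdaDecay`) and `‖∇a_R‖ ≤ M₁/R` on a volume `8|B₁|R³`:

* `fracLapHalf_slice_bound` — `‖Λ(v t)(x)‖ ≤ K′/(‖x‖+√(−t))²` from `ScaleInvariantBounds`, `K′ = (24|B₁|/π²)(|L₀|+|L₂|)`;
* `exists_annulusFlux_bound` — **`|2∫q ∇a_R·Λv| + |2∑ᵢ∫∂ᵢa_R⟪∂ᵢv, Λv⟫| ≤ C_A · R²((R+√(−t))⁴)⁻¹`** for all `R > 0`,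
  `t < 0` (the time integral `∫₀^∞ R²(R+√s)⁻⁴ds ≤ 1` is the tree's `…TimeIntegratedError.integral_Iio_kernel_le`).

Seat nsreg-p6 g13 (THEOREMS-ONLY door sequels, DIRECTOR-NS g8 #32 (2)/#36).  WHAT THIS IS NOT: not NS regularity (Clay A);
two of the four flux terms of F3 (the commutator pairing is `…CriticalFluxDoorCommutator*`); no route is opened.
-/

noncomputable section

-- the summit and its single sub-problem share the name (CONVENTIONS §1), as in every Theorems file
set_option linter.dupNamespace false

namespace Summit.NavierStokesRegularity.NavierStokesRegularity.Theorems.CriticalFluxDoorAnnulusFlux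

open MeasureTheory Metric Set Filter Topology Function
open scoped RealInnerProductSpace
open Literature.Analysis Literature.Analysis.FluidPDE
open Summit.NavierStokesRegularity.NavierStokesRegularity.Theorems.ChiralWindowDoorDefs
open Summit.NavierStokesRegularity.NavierStokesRegularity.Theorems.CriticalFluxDoorDefs
open Summit.NavierStokesRegularity.NavierStokesRegularity.Theorems.RellichScarScarRigidity (ScaleInvariantBounds)
open Summit.NavierStokesRegularity.NavierStokesRegularity.Theorems.ChiralWindowDoorHelicityFluxBounds
  (exists_norm_fderiv_bumpSq_le fderiv_bumpSq_eq_zero_of_norm_lt fderiv_bumpSq_eq_zero_of_lt_norm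
    abs_integral_le_of_ball_bound le_div_pow_of_mul_le)
open Summit.NavierStokesRegularity.NavierStokesRegularity.Theorems.CriticalFluxDoorLambdaDecay
  (norm_fracLapHalf_le_weighted)

variable {η : EuclideanSpace ℝ (Fin 3) → ℝ} {v : ℝ → EuclideanSpace ℝ (Fin 3) → EuclideanSpace ℝ (Fin 3)}
  {q : ℝ → EuclideanSpace ℝ (Fin 3) → ℝ}

/-! ### `‖Λv(t,x)‖ ≤ K′/(‖x‖+√(−t))²` from the scale-invariant package -/

/-- **`‖Λ(v t)(x)‖ ≤ K′/(‖x‖+√(−t))²`** for a classical unit-viscosity solution with the scale-invariant package,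
`K′ = (24|B₁|/π²)(|L₀|+|L₂|)` from the orders `0` and `2` (the weighted `Λ`-decay lemma). -/
theorem fracLapHalf_slice_bound (hsol : IsClassicalNSSolutionOn (Iio (0 : ℝ)) 1 0 v q) (hSIB : ScaleInvariantBounds v q) :
    ∃ K' : ℝ, 0 ≤ K' ∧ ∀ t < (0 : ℝ), ∀ x : EuclideanSpace ℝ (Fin 3),
      ‖fracLapHalf (v t) x‖ ≤ K' / (‖x‖ + Real.sqrt (-t)) ^ 2 := by
  obtain ⟨L₀, hL₀⟩ := hSIB 0
  obtain ⟨L₂, hL₂⟩ := hSIB 2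
  refine ⟨lamDecayConst * (|L₀| + |L₂|), mul_nonneg lamDecayConst_nonneg (by positivity), fun t ht x => ?_⟩
  have hsq : 0 < Real.sqrt (-t) := Real.sqrt_pos.2 (neg_pos.2 ht)
  have hcd : ContDiff ℝ 2 (v t) := contDiff_infty.1 (hsol.contDiff_velocity ht) 2
  have hA : ∀ y, ‖v t y‖ ≤ |L₀| / (‖y‖ + Real.sqrt (-t)) := fun y => by
    have h := (hL₀ t ht y).1
    rw [norm_iteratedFDeriv_zero, add_zero, pow_one] at h
    exact h.trans (div_le_div_of_nonneg_right (le_abs_self _) (by positivity))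
  have hB : ∀ y, ‖fderiv ℝ (fderiv ℝ (v t)) y‖ ≤ |L₂| / (‖y‖ + Real.sqrt (-t)) ^ 3 := fun y => by
    have h := (hL₂ t ht y).1
    rw [← norm_iteratedFDeriv_one (𝕜 := ℝ) (fderiv ℝ (v t)), norm_iteratedFDeriv_fderiv]
    exact h.trans (div_le_div_of_nonneg_right (le_abs_self _) (by positivity))
  exact norm_fracLapHalf_le_weighted hcd hsq hA hB x

/-! ### The two annulus fluxes -/

/-- **The annulus fluxes of F3 are `O(R²/(R+√(−t))⁴)`**: for a classical unit-viscosity solution with the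
scale-invariant package and the weights `a_R = η(·/R)²` of an admissible bump, there is `C_A ≥ 0` with
`|2∫ q ∇a_R·Λv| + |2∑ᵢ∫ ∂ᵢa_R ⟪∂ᵢv, Λv⟫| ≤ C_A · R²((R+√(−t))⁴)⁻¹` for all `R > 0`, `t < 0`. -/
theorem exists_annulusFlux_bound (hη : IsAdmissibleBump η) (hsol : IsClassicalNSSolutionOn (Iio (0 : ℝ)) 1 0 v q)
    (hSIB : ScaleInvariantBounds v q) :
    ∃ C_A : ℝ, 0 ≤ C_A ∧ ∀ R > (0 : ℝ), ∀ t < (0 : ℝ),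
      |2 * ∫ x, q t x * fderiv ℝ (bumpSq η R) x (fracLapHalf (v t) x)| +
          |2 * ∑ i : Fin 3, ∫ x, fderiv ℝ (bumpSq η R) x (EuclideanSpace.single i 1) *
            ⟪pderiv i (v t) x, fracLapHalf (v t) x⟫| ≤
        C_A * (R ^ 2 * ((R + Real.sqrt (-t)) ^ 4)⁻¹) := by
  obtain ⟨M₁, hM₁, hDa⟩ := exists_norm_fderiv_bumpSq_le hη
  obtain ⟨K', hK'0, hK'⟩ := fracLapHalf_slice_bound hsol hSIB
  obtain ⟨Lq, hLq⟩ := hSIB 0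
  obtain ⟨L₁, hL₁⟩ := hSIB 1
  set V₁ : ℝ := (volume : Measure (EuclideanSpace ℝ (Fin 3))).real (closedBall 0 1) with hV₁
  have hV₁0 : 0 ≤ V₁ := measureReal_nonneg
  set c₁ : ℝ := |Lq| * M₁ * K' with hc₁
  set c₂ : ℝ := M₁ * |L₁| * K' with hc₂
  refine ⟨2 * (8 * V₁ * c₁) + 2 * (3 * (8 * V₁ * c₂)), by positivity, fun R hR t ht => ?_⟩
  have hnt : 0 < -t := neg_pos.2 ht
  have hsq : 0 < Real.sqrt (-t) := Real.sqrt_pos.2 hnt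
  set β : ℝ := R + Real.sqrt (-t) with hβ
  have hβ0 : 0 < β := by positivity
  -- pointwise decay on the annulus `R ≤ ‖x‖`
  have hdec : ∀ x : EuclideanSpace ℝ (Fin 3), R ≤ ‖x‖ →
      |q t x| ≤ |Lq| / β ^ 2 ∧ (∀ i : Fin 3, ‖pderiv i (v t) x‖ ≤ |L₁| / β ^ 2) ∧ ‖fracLapHalf (v t) x‖ ≤ K' / β ^ 2 := by
    intro x hx
    have hb : β ≤ ‖x‖ + Real.sqrt (-t) := by rw [hβ]; linarith
    have hpos : 0 < ‖x‖ + Real.sqrt (-t) := by positivity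
    refine ⟨?_, fun i => ?_, ?_⟩
    · have h := (hLq t ht x).2.1
      rw [norm_iteratedFDeriv_zero, Real.norm_eq_abs, add_zero] at h
      calc |q t x| ≤ Lq / (‖x‖ + Real.sqrt (-t)) ^ 2 := h
        _ ≤ |Lq| / (‖x‖ + Real.sqrt (-t)) ^ 2 := div_le_div_of_nonneg_right (le_abs_self _) (by positivity)
        _ ≤ |Lq| / β ^ 2 := div_le_div_of_nonneg_left (abs_nonneg _) (by positivity) (pow_le_pow_left₀ hβ0.le hb 2)
    · have h := (hL₁ t ht x).1
      rw [norm_iteratedFDeriv_one] at h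
      rw [pderiv_eq]
      calc ‖fderiv ℝ (v t) x (EuclideanSpace.single i 1)‖ ≤ ‖fderiv ℝ (v t) x‖ * ‖EuclideanSpace.single i (1 : ℝ)‖ :=
            ContinuousLinearMap.le_opNorm _ _
        _ = ‖fderiv ℝ (v t) x‖ := by rw [PiLp.norm_single, norm_one, mul_one]
        _ ≤ L₁ / (‖x‖ + Real.sqrt (-t)) ^ (1 + 1) := h
        _ ≤ |L₁| / (‖x‖ + Real.sqrt (-t)) ^ 2 := div_le_div_of_nonneg_right (le_abs_self _) (by positivity)
        _ ≤ |L₁| / β ^ 2 := div_le_div_of_nonneg_left (abs_nonneg _) (by positivity) (pow_le_pow_left₀ hβ0.le hb 2)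
    · exact (hK' t ht x).trans (div_le_div_of_nonneg_left hK'0 (by positivity) (pow_le_pow_left₀ hβ0.le hb 2))
  -- the integrands
  set T₁ : EuclideanSpace ℝ (Fin 3) → ℝ := fun x => q t x * fderiv ℝ (bumpSq η R) x (fracLapHalf (v t) x) with hT₁
  set T₂ : Fin 3 → EuclideanSpace ℝ (Fin 3) → ℝ := fun i x =>
    fderiv ℝ (bumpSq η R) x (EuclideanSpace.single i 1) * ⟪pderiv i (v t) x, fracLapHalf (v t) x⟫ with hT₂
  -- they vanish where `∇a_R = 0`
  have hzero : ∀ x, fderiv ℝ (bumpSq η R) x = 0 → T₁ x = 0 ∧ ∀ i, T₂ i x = 0 := fun x h0 => by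
    simp only [hT₁, hT₂, h0, _root_.zero_apply, mul_zero, zero_mul, implies_true, and_self]
  have hout₁ : ∀ x, 2 * R < ‖x‖ → T₁ x = 0 := fun x hx => (hzero x (fderiv_bumpSq_eq_zero_of_lt_norm hη hR hx)).1
  have hout₂ : ∀ i x, 2 * R < ‖x‖ → T₂ i x = 0 := fun i x hx => (hzero x (fderiv_bumpSq_eq_zero_of_lt_norm hη hR hx)).2 i
  -- pointwise bounds on `‖x‖ ≤ 2R`
  have hin₁ : ∀ x, ‖x‖ ≤ 2 * R → |T₁ x| ≤ c₁ / (R * β ^ 4) := by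
    intro x _
    by_cases hxR : ‖x‖ < R
    · rw [(hzero x (fderiv_bumpSq_eq_zero_of_norm_lt hη hR hxR)).1, abs_zero]; positivity
    obtain ⟨hq', -, hΛ⟩ := hdec x (not_lt.1 hxR)
    have ha := hDa R hR x
    have h2 : |fderiv ℝ (bumpSq η R) x (fracLapHalf (v t) x)| ≤ M₁ / R * (K' / β ^ 2) := by
      rw [← Real.norm_eq_abs]
      exact (ContinuousLinearMap.le_opNorm _ _).trans (mul_le_mul ha hΛ (norm_nonneg _) (by positivity))
    calc |T₁ x| = |q t x| * |fderiv ℝ (bumpSq η R) x (fracLapHalf (v t) x)| := by rw [hT₁]; exact abs_mul _ _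
      _ ≤ |Lq| / β ^ 2 * (M₁ / R * (K' / β ^ 2)) := mul_le_mul hq' h2 (abs_nonneg _) (by positivity)
      _ = c₁ / (R * β ^ 4) := by rw [hc₁]; field_simp
  have hin₂ : ∀ i x, ‖x‖ ≤ 2 * R → |T₂ i x| ≤ c₂ / (R * β ^ 4) := by
    intro i x _
    by_cases hxR : ‖x‖ < R
    · rw [(hzero x (fderiv_bumpSq_eq_zero_of_norm_lt hη hR hxR)).2 i, abs_zero]; positivity
    obtain ⟨-, hD, hΛ⟩ := hdec x (not_lt.1 hxR)
    have ha := hDa R hR x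
    have h1 : |fderiv ℝ (bumpSq η R) x (EuclideanSpace.single i 1)| ≤ M₁ / R := by
      rw [← Real.norm_eq_abs]
      calc ‖fderiv ℝ (bumpSq η R) x (EuclideanSpace.single i 1)‖
          ≤ ‖fderiv ℝ (bumpSq η R) x‖ * ‖EuclideanSpace.single i (1 : ℝ)‖ := ContinuousLinearMap.le_opNorm _ _
        _ = ‖fderiv ℝ (bumpSq η R) x‖ := by rw [PiLp.norm_single, norm_one, mul_one]
        _ ≤ M₁ / R := ha
    have h2 : |⟪pderiv i (v t) x, fracLapHalf (v t) x⟫| ≤ |L₁| / β ^ 2 * (K' / β ^ 2) :=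
      (abs_real_inner_le_norm _ _).trans (mul_le_mul (hD i) hΛ (norm_nonneg _) (by positivity))
    calc |T₂ i x| = |fderiv ℝ (bumpSq η R) x (EuclideanSpace.single i 1)| * |⟪pderiv i (v t) x, fracLapHalf (v t) x⟫| := by
          rw [hT₂]; exact abs_mul _ _
      _ ≤ M₁ / R * (|L₁| / β ^ 2 * (K' / β ^ 2)) := mul_le_mul h1 h2 (abs_nonneg _) (by positivity)
      _ = c₂ / (R * β ^ 4) := by rw [hc₂]; field_simp
  -- the integral bounds
  have hI : ∀ {T : EuclideanSpace ℝ (Fin 3) → ℝ} {c : ℝ}, (∀ x, ‖x‖ ≤ 2 * R → |T x| ≤ c / (R * β ^ 4)) →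
      (∀ x, 2 * R < ‖x‖ → T x = 0) → |∫ x, T x| ≤ 8 * V₁ * c * (R ^ 2 * (β ^ 4)⁻¹) := by
    intro T c hTin hTout
    refine (abs_integral_le_of_ball_bound hR hTin hTout).trans (le_of_eq ?_)
    rw [hV₁]
    field_simp
  have e₁ := hI hin₁ hout₁
  have e₂ : ∀ i : Fin 3, |∫ x, T₂ i x| ≤ 8 * V₁ * c₂ * (R ^ 2 * (β ^ 4)⁻¹) := fun i => hI (hin₂ i) (hout₂ i)
  have hsum : |∑ i : Fin 3, ∫ x, T₂ i x| ≤ 3 * (8 * V₁ * c₂ * (R ^ 2 * (β ^ 4)⁻¹)) := by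
    refine (Finset.abs_sum_le_sum_abs _ _).trans ?_
    calc ∑ i : Fin 3, |∫ x, T₂ i x| ≤ ∑ _i : Fin 3, 8 * V₁ * c₂ * (R ^ 2 * (β ^ 4)⁻¹) :=
          Finset.sum_le_sum fun i _ => e₂ i
      _ = 3 * (8 * V₁ * c₂ * (R ^ 2 * (β ^ 4)⁻¹)) := by
          rw [Finset.sum_const, Finset.card_univ, Fintype.card_fin]; simp
  show |2 * ∫ x, T₁ x| + |2 * ∑ i : Fin 3, ∫ x, T₂ i x| ≤
    (2 * (8 * V₁ * c₁) + 2 * (3 * (8 * V₁ * c₂))) * (R ^ 2 * (β ^ 4)⁻¹)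
  rw [abs_mul, abs_mul, abs_of_pos (by norm_num : (0 : ℝ) < 2)]
  nlinarith [e₁, hsum, sq_nonneg R, inv_nonneg.2 (pow_nonneg hβ0.le 4)]

end Summit.NavierStokesRegularity.NavierStokesRegularity.Theorems.CriticalFluxDoorAnnulusFlux

end
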